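import Summits.HodgeConjecture.HodgeConjecture.Theorems.Ring2WeilCoverageCMFieldNormWitnesses
import Mathlib.Tactic.ComputeDegree
import HarnessLib

/-!
# Ring 2 — Weil-type family-coverage census, CM-field rows (X-Z): generic tools for the RATIONAL rows
# `[q]`, `q ∈ ℚ^×`, of a SEXTIC table — coordinates and the norm form on a cubic carrier `F = ℚ[S]/(R)`,
# the `K`-witness `[x² + c₀y²] = [1]`, and the descent for a binary form `U² + eUV + fV² = ℓ·w·M²`

HONEST FRAMING: research route conditional on HC_CM; not a corollary; Q11.4-sentence-2 already refuted in dim ≥ 3.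

Cell `pub-hodge-ring2`, seat `ring2-b03` (gen 59), census `WEIL-FAMILY-COVERAGE.md` «## b03» (operator priority5
2026-08-22T11:46:08Z), the `g = 12` rows `(3,2)` (b03.8/b03.23): `E` a sextic CM field over a totally real cubic `F`,
components `W12.E.δ` indexed by `δ ∈ F^×/Nm_{E/F}(E^×)` (`Deligne1982.cmNormResidueGroup R` on the carriers
`F = realField R = ℚ[S]/(R)`, `E = cmField R = ℚ[T]/(R(T²))`, Deligne §4 (1), Lemma 4.6, Cor. 4.2). Parts X-X/X-Y
(gen 58) decided the rows `[3w]`, `[5w]` of `ℚ(ζ₇)` by `3⁶`- and `5⁶`-case anisotropy checks. This part supplies the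
GENERIC pieces with which parts X-AA (`ℚ(ζ₇)`) and X-AB (`ℚ(ζ₉)`) decide EVERY rational row `[q]`, `q ∈ ℚ^×`, at once:

* §1 coordinates on a cubic `F`: `exists_coords_of_natDegree_eq_three` (`F = ℚ ⊕ ℚσ ⊕ ℚσ²` for `R` monic of degree
  `3`), `coords_eq_zero_of_natDegree_eq_three` (`{1, σ, σ²}` free), `root_rel_of_realPolyQ_eq`
  (`σ³ + aσ² + bσ + c = 0`), and **`normForm_coords_of_realPolyQ_eq`** — the norm form `N(A, B) = A² − σB²` of
  `E/F` (`z z̄` for `z = A + Bη`, part I `norm_coords`) in the coordinates `A = a₀ + a₁σ + a₂σ²`, `B = b₀ + b₁σ + b₂σ²`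
  as THREE rational quadratic forms `N₀, N₁, N₂` in six variables with coefficients in `ℤ[a, b, c]` (generic in the
  carrier `R = S³ + aS² + bS + c`; the `ℚ(ζ₇)` specialisation is the triple met in part X-X);
  `coords_of_normForm_eq_of` (`A² − σB² = q ∈ ℚ ⟹ N₀ = q, N₁ = N₂ = 0`).
* §2 **`mk_eq_splitDiscriminantClassCM_two_of_sq_add_mul_sq`** (any carrier): if `t ∈ F` has `σt² = −c₀` — i.e.
  `s = tη ∈ E` has `s̄ = −s`, `s² = −c₀`, so `E ⊇ K = ℚ(√−c₀)` — then `[x² + c₀y²] = [(−1)²] = [1]` for all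
  `x, y ∈ ℚ` (`x² + c₀y² = N(x, yt) = Nm_{E/F}(x + ys)`: the norms from `K` are norms from `E`).
* §3 the arithmetic of the OTHER direction: **`binaryForm_descent`** — for a prime `ℓ`, a binary form
  `U² + eUV + fV²` anisotropic mod `ℓ` and `ℓ ∤ w`, `U² + eUV + fV² = ℓ·w·M²` forces `M = 0` (reduction mod `ℓ`,
  `ℓ ∣ U, V`, `ℓ ∣ M`, descent); `prime_mul_ne_binaryForm` (no RATIONAL `x, y` with `x² + exy + fy² = ℓw`);
  `aniso_sq_add_mul_sq_of_not_isSquare` (`x² + fy²` is anisotropic mod `ℓ` when `−f` is a non-square mod `ℓ`) and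
  `aniso_two_sq_add_mul_add_sq` (`u² + uv + v²` mod `2`, the dyadic case of `x² + 3y²`).

Why this decides the rational rows (parts X-AA/X-AB): when `[F:ℚ] = 3` is ODD and `E ⊇ K = ℚ(√−c₀)`, for `q ∈ ℚ^×`
one has `[q] = [1] ⟺ q ∈ N_{K/ℚ}(K^×) = {x² + c₀y²}`: «⟸» is §2; «⟹»: `q = Nm_{E/F}(z)` gives
`q³ = N_{F/ℚ}(q) = N_{E/ℚ}(z) = N_{K/ℚ}(N_{E/K} z) = X² + c₀Y²`, hence `q = (X/q)² + c₀(Y/q)²` — in the kernel as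
an explicit polynomial identity `N₀³ ≡ X² + c₀Y² mod (N₁, N₂)` in the six coordinates (parts X-AA/X-AB), no Galois
theory invoked. THEOREMS ONLY: no `def`, no named fact, no `sorry`; `HC_CM` does not occur; nothing about the Hodge
conjecture is asserted (`[q] = [1]` / `≠ [1]` says which component `W12.E.[q]` is the split one, Deligne Cor. 4.2).

## References
* [Deligne1982HodgeCycles] P. Deligne (notes by J. S. Milne), LNM 900 (1982), §4 p. 30 (1), Cor. 4.2, Lemma 4.6.
* [Landherr1936HermitianForms] W. Landherr, Abh. Math. Sem. Hamburg 11 (1936) 245–248.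
* J. Neukirch, *Algebraic Number Theory*, Springer 1999, Ch. I §2 (descent for binary forms), Ch. II Cor. 2.9
  (transitivity of the norm) — background only.
-/

noncomputable section

set_option linter.dupNamespace false

open Polynomial

namespace Summit.HodgeConjecture.HodgeConjecture.Ring2.WeilCoverageCM

open Literature.AlgebraicGeometry.Deligne1982
open Literature.AlgebraicGeometry.HodgeTheory (splitDiscriminantClassCM)

/-! ### §1 Coordinates and the norm form on a cubic carrier `F = ℚ[S]/(R)` -/

section CubicCoordinates

variable {R : Polynomial ℤ} [Fact (Irreducible (realPolyQ R))]

/-- **`F = ℚ ⊕ ℚσ ⊕ ℚσ²`** for `R` monic of degree `3`: every element of `F = ℚ[S]/(R)` is `ι p + ι q · σ + ι r · σ²`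
(division with remainder by `R`). [cite: Deligne1982HodgeCycles, §4 p. 30] -/
theorem exists_coords_of_natDegree_eq_three (hmonic : (realPolyQ R).Monic) (hdeg : (realPolyQ R).natDegree = 3)
    (x : realField R) :
    ∃ p q r : ℚ, x = AdjoinRoot.of (realPolyQ R) p + AdjoinRoot.of (realPolyQ R) q * AdjoinRoot.root (realPolyQ R) +
      AdjoinRoot.of (realPolyQ R) r * AdjoinRoot.root (realPolyQ R) ^ 2 := by
  have hne1 : realPolyQ R ≠ 1 := by
    intro h1
    rw [h1, natDegree_one] at hdeg
    exact absurd hdeg (by norm_num)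
  induction x using AdjoinRoot.induction_on with
  | ih P =>
    have hmk : (AdjoinRoot.mk (realPolyQ R) P : realField R) =
        AdjoinRoot.mk (realPolyQ R) (P %ₘ realPolyQ R) := by
      rw [AdjoinRoot.mk_eq_mk]
      refine ⟨P /ₘ realPolyQ R, ?_⟩
      calc P - P %ₘ realPolyQ R
          = (P %ₘ realPolyQ R + realPolyQ R * (P /ₘ realPolyQ R)) - P %ₘ realPolyQ R := by
            rw [Polynomial.modByMonic_add_div P (realPolyQ R)]
        _ = realPolyQ R * (P /ₘ realPolyQ R) := by ring
    have hrdeg : (P %ₘ realPolyQ R).natDegree < 3 := by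
      have := Polynomial.natDegree_modByMonic_lt P hmonic hne1
      rw [hdeg] at this
      exact this
    refine ⟨(P %ₘ realPolyQ R).coeff 0, (P %ₘ realPolyQ R).coeff 1, (P %ₘ realPolyQ R).coeff 2, ?_⟩
    rw [hmk]
    conv_lhs => rw [Polynomial.as_sum_range' (P %ₘ realPolyQ R) 3 hrdeg]
    simp only [Finset.sum_range_succ, Finset.sum_range_zero, zero_add, ← Polynomial.C_mul_X_pow_eq_monomial,
      map_add, map_mul, map_pow, AdjoinRoot.mk_C, AdjoinRoot.mk_X, pow_zero, mul_one, pow_one]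

/-- **`{1, σ, σ²}` is `ℚ`-free** for `R` monic of degree `3`: `ι p + ι q · σ + ι r · σ² = 0 ⇒ p = q = r = 0`.
[cite: Deligne1982HodgeCycles, §4 p. 30] -/
theorem coords_eq_zero_of_natDegree_eq_three (hmonic : (realPolyQ R).Monic) (hdeg : (realPolyQ R).natDegree = 3)
    {p q r : ℚ}
    (h : AdjoinRoot.of (realPolyQ R) p + AdjoinRoot.of (realPolyQ R) q * AdjoinRoot.root (realPolyQ R) +
      AdjoinRoot.of (realPolyQ R) r * AdjoinRoot.root (realPolyQ R) ^ 2 = 0) :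
    p = 0 ∧ q = 0 ∧ r = 0 := by
  have hmk : (AdjoinRoot.mk (realPolyQ R) (C p + C q * X + C r * X ^ 2) : realField R) = 0 := by
    rw [map_add, map_add, map_mul, map_mul, map_pow, AdjoinRoot.mk_C, AdjoinRoot.mk_C, AdjoinRoot.mk_C, AdjoinRoot.mk_X]
    exact h
  rw [AdjoinRoot.mk_eq_zero] at hmk
  by_cases h0 : C p + C q * X + C r * X ^ 2 = 0
  · have h1 := congrArg (fun f : Polynomial ℚ => f.coeff 0) h0
    have h2 := congrArg (fun f : Polynomial ℚ => f.coeff 1) h0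
    have h3 := congrArg (fun f : Polynomial ℚ => f.coeff 2) h0
    simp at h1 h2 h3
    exact ⟨h1, h2, h3⟩
  · exfalso
    refine hmonic.not_dvd_of_natDegree_lt h0 ?_ hmk
    rw [hdeg]
    have : (C p + C q * X + C r * X ^ 2).natDegree ≤ 2 := by compute_degree
    omega

/-- **`σ³ + aσ² + bσ + c = 0`** in `F = ℚ[S]/(S³ + aS² + bS + c)`. [cite: Deligne1982HodgeCycles, §4 p. 30] -/
theorem root_rel_of_realPolyQ_eq {a b c : ℚ} (hRQ : realPolyQ R = X ^ 3 + C a * X ^ 2 + C b * X + C c) :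
    AdjoinRoot.root (realPolyQ R) ^ 3 + AdjoinRoot.of (realPolyQ R) a * AdjoinRoot.root (realPolyQ R) ^ 2 +
      AdjoinRoot.of (realPolyQ R) b * AdjoinRoot.root (realPolyQ R) + AdjoinRoot.of (realPolyQ R) c = 0 := by
  have h : AdjoinRoot.mk (realPolyQ R) (X ^ 3 + C a * X ^ 2 + C b * X + C c) = 0 := by
    rw [← hRQ]
    exact AdjoinRoot.mk_self
  simpa only [map_add, map_mul, map_pow, AdjoinRoot.mk_C, AdjoinRoot.mk_X] using h

/-- **The norm form of `E/F` in coordinates on a cubic carrier.** For `R = S³ + aS² + bS + c` and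
`A = a₀ + a₁σ + a₂σ²`, `B = b₀ + b₁σ + b₂σ²` (`σ = S mod R`): `A² − σB² = N₀ + N₁σ + N₂σ²` with the three rational
quadratic forms `N₀, N₁, N₂` below (reduction by `σ³ = −aσ² − bσ − c`; `A² − σB² = z z̄` for `z = A + Bη`, part I
`norm_coords`). Generic in `a, b, c`; at `(a, b, c) = (7, 14, 7)` these are the forms of part X-X.
[cite: Deligne1982HodgeCycles, §4 p. 30] -/
theorem normForm_coords_of_realPolyQ_eq {a b c : ℚ} (hRQ : realPolyQ R = X ^ 3 + C a * X ^ 2 + C b * X + C c)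
    (a₀ a₁ a₂ b₀ b₁ b₂ : ℚ) :
    (AdjoinRoot.of (realPolyQ R) a₀ + AdjoinRoot.of (realPolyQ R) a₁ * AdjoinRoot.root (realPolyQ R) +
        AdjoinRoot.of (realPolyQ R) a₂ * AdjoinRoot.root (realPolyQ R) ^ 2) ^ 2 -
      AdjoinRoot.root (realPolyQ R) *
        (AdjoinRoot.of (realPolyQ R) b₀ + AdjoinRoot.of (realPolyQ R) b₁ * AdjoinRoot.root (realPolyQ R) +
          AdjoinRoot.of (realPolyQ R) b₂ * AdjoinRoot.root (realPolyQ R) ^ 2) ^ 2 =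
    AdjoinRoot.of (realPolyQ R) (a ^ 2 * c * b₂ ^ 2 + a * c * a₂ ^ 2 - 2 * a * c * b₁ * b₂ - b * c * b₂ ^ 2
        - 2 * c * a₁ * a₂ + 2 * c * b₀ * b₂ + c * b₁ ^ 2 + a₀ ^ 2) +
      AdjoinRoot.of (realPolyQ R) (a ^ 2 * b * b₂ ^ 2 + a * b * a₂ ^ 2 - 2 * a * b * b₁ * b₂ - a * c * b₂ ^ 2
        - b ^ 2 * b₂ ^ 2 - 2 * b * a₁ * a₂ + 2 * b * b₀ * b₂ + b * b₁ ^ 2 - c * a₂ ^ 2 + 2 * c * b₁ * b₂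
        + 2 * a₀ * a₁ - b₀ ^ 2) * AdjoinRoot.root (realPolyQ R) +
      AdjoinRoot.of (realPolyQ R) (a ^ 3 * b₂ ^ 2 + a ^ 2 * a₂ ^ 2 - 2 * a ^ 2 * b₁ * b₂ - 2 * a * b * b₂ ^ 2
        - 2 * a * a₁ * a₂ + 2 * a * b₀ * b₂ + a * b₁ ^ 2 - b * a₂ ^ 2 + 2 * b * b₁ * b₂ + c * b₂ ^ 2 + 2 * a₀ * a₂
        + a₁ ^ 2 - 2 * b₀ * b₁) * AdjoinRoot.root (realPolyQ R) ^ 2 := by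
  have hσ := root_rel_of_realPolyQ_eq hRQ
  simp only [map_add, map_sub, map_mul, map_pow, map_ofNat]
  linear_combination (-AdjoinRoot.of (realPolyQ R) a ^ 2 * AdjoinRoot.of (realPolyQ R) b₂ ^ 2
      + AdjoinRoot.of (realPolyQ R) a * AdjoinRoot.of (realPolyQ R) b₂ ^ 2 * AdjoinRoot.root (realPolyQ R)
      - AdjoinRoot.of (realPolyQ R) b₂ ^ 2 * AdjoinRoot.root (realPolyQ R) ^ 2
      - AdjoinRoot.of (realPolyQ R) a * AdjoinRoot.of (realPolyQ R) a₂ ^ 2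
      + 2 * AdjoinRoot.of (realPolyQ R) a * AdjoinRoot.of (realPolyQ R) b₁ * AdjoinRoot.of (realPolyQ R) b₂
      + AdjoinRoot.of (realPolyQ R) b * AdjoinRoot.of (realPolyQ R) b₂ ^ 2
      + AdjoinRoot.of (realPolyQ R) a₂ ^ 2 * AdjoinRoot.root (realPolyQ R)
      - 2 * AdjoinRoot.of (realPolyQ R) b₁ * AdjoinRoot.of (realPolyQ R) b₂ * AdjoinRoot.root (realPolyQ R)
      + 2 * AdjoinRoot.of (realPolyQ R) a₁ * AdjoinRoot.of (realPolyQ R) a₂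
      - 2 * AdjoinRoot.of (realPolyQ R) b₀ * AdjoinRoot.of (realPolyQ R) b₂
      - AdjoinRoot.of (realPolyQ R) b₁ ^ 2) * hσ

/-- **`A² − σB² = q ∈ ℚ` in coordinates**: `N₀ = q`, `N₁ = 0`, `N₂ = 0` (`{1, σ, σ²}` is free).
[cite: Deligne1982HodgeCycles, §4 p. 30] -/
theorem coords_of_normForm_eq_of {a b c : ℚ} (hRQ : realPolyQ R = X ^ 3 + C a * X ^ 2 + C b * X + C c)
    {a₀ a₁ a₂ b₀ b₁ b₂ q : ℚ}
    (h : (AdjoinRoot.of (realPolyQ R) a₀ + AdjoinRoot.of (realPolyQ R) a₁ * AdjoinRoot.root (realPolyQ R) +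
        AdjoinRoot.of (realPolyQ R) a₂ * AdjoinRoot.root (realPolyQ R) ^ 2) ^ 2 -
      AdjoinRoot.root (realPolyQ R) *
        (AdjoinRoot.of (realPolyQ R) b₀ + AdjoinRoot.of (realPolyQ R) b₁ * AdjoinRoot.root (realPolyQ R) +
          AdjoinRoot.of (realPolyQ R) b₂ * AdjoinRoot.root (realPolyQ R) ^ 2) ^ 2 =
      AdjoinRoot.of (realPolyQ R) q) :
    a ^ 2 * c * b₂ ^ 2 + a * c * a₂ ^ 2 - 2 * a * c * b₁ * b₂ - b * c * b₂ ^ 2 - 2 * c * a₁ * a₂ + 2 * c * b₀ * b₂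
        + c * b₁ ^ 2 + a₀ ^ 2 = q ∧
      a ^ 2 * b * b₂ ^ 2 + a * b * a₂ ^ 2 - 2 * a * b * b₁ * b₂ - a * c * b₂ ^ 2 - b ^ 2 * b₂ ^ 2 - 2 * b * a₁ * a₂
        + 2 * b * b₀ * b₂ + b * b₁ ^ 2 - c * a₂ ^ 2 + 2 * c * b₁ * b₂ + 2 * a₀ * a₁ - b₀ ^ 2 = 0 ∧
      a ^ 3 * b₂ ^ 2 + a ^ 2 * a₂ ^ 2 - 2 * a ^ 2 * b₁ * b₂ - 2 * a * b * b₂ ^ 2 - 2 * a * a₁ * a₂ + 2 * a * b₀ * b₂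
        + a * b₁ ^ 2 - b * a₂ ^ 2 + 2 * b * b₁ * b₂ + c * b₂ ^ 2 + 2 * a₀ * a₂ + a₁ ^ 2 - 2 * b₀ * b₁ = 0 := by
  have hmonic : (realPolyQ R).Monic := by rw [hRQ]; monicity!
  have hdeg : (realPolyQ R).natDegree = 3 := by rw [hRQ]; compute_degree!
  rw [normForm_coords_of_realPolyQ_eq hRQ] at h
  have key : AdjoinRoot.of (realPolyQ R) (a ^ 2 * c * b₂ ^ 2 + a * c * a₂ ^ 2 - 2 * a * c * b₁ * b₂ - b * c * b₂ ^ 2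
        - 2 * c * a₁ * a₂ + 2 * c * b₀ * b₂ + c * b₁ ^ 2 + a₀ ^ 2 - q) +
      AdjoinRoot.of (realPolyQ R) (a ^ 2 * b * b₂ ^ 2 + a * b * a₂ ^ 2 - 2 * a * b * b₁ * b₂ - a * c * b₂ ^ 2
        - b ^ 2 * b₂ ^ 2 - 2 * b * a₁ * a₂ + 2 * b * b₀ * b₂ + b * b₁ ^ 2 - c * a₂ ^ 2 + 2 * c * b₁ * b₂
        + 2 * a₀ * a₁ - b₀ ^ 2) * AdjoinRoot.root (realPolyQ R) +
      AdjoinRoot.of (realPolyQ R) (a ^ 3 * b₂ ^ 2 + a ^ 2 * a₂ ^ 2 - 2 * a ^ 2 * b₁ * b₂ - 2 * a * b * b₂ ^ 2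
        - 2 * a * a₁ * a₂ + 2 * a * b₀ * b₂ + a * b₁ ^ 2 - b * a₂ ^ 2 + 2 * b * b₁ * b₂ + c * b₂ ^ 2 + 2 * a₀ * a₂
        + a₁ ^ 2 - 2 * b₀ * b₁) * AdjoinRoot.root (realPolyQ R) ^ 2 = 0 := by
    rw [map_sub]
    linear_combination h
  obtain ⟨h0, h1, h2⟩ := coords_eq_zero_of_natDegree_eq_three hmonic hdeg key
  exact ⟨by linarith, h1, h2⟩

end CubicCoordinates

/-! ### §2 The `K`-witness: norms from `K = ℚ(√−c₀) ⊆ E` are norms from `E` -/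

section KWitness

variable {R : Polynomial ℤ} [Fact (Irreducible (realPolyQ R))] [Fact (Irreducible (cmPolyQ R))]

/-- **`[x² + c₀y²] = [(−1)²] = [1]` when `E ⊇ ℚ(√−c₀)`.** If `t ∈ F` has `σt² = −c₀` (so `s = tη ∈ E` has
`s̄ = −s`, `s² = −c₀`), then for all `x, y ∈ ℚ` the class of `x² + c₀y² ∈ F^×` is the split class: with `A = x`,
`B = yt`, `A² − σB² = x² − (σt²)y² = x² + c₀y²`, i.e. `x² + c₀y² = Nm_{E/F}(x + ys)` (part VI
`mk_eq_splitDiscriminantClassCM_two_of_normForm`). [cite: Deligne1982HodgeCycles, §4 p. 30 (1) and Cor. 4.2 (a)] -/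
theorem mk_eq_splitDiscriminantClassCM_two_of_sq_add_mul_sq {c₀ : ℚ} (t : realField R)
    (ht : AdjoinRoot.root (realPolyQ R) * t ^ 2 = AdjoinRoot.of (realPolyQ R) (-c₀)) (x y : ℚ)
    (q : (realField R)ˣ) (hq : (q : realField R) = AdjoinRoot.of (realPolyQ R) (x ^ 2 + c₀ * y ^ 2)) :
    (QuotientGroup.mk q : cmNormResidueGroup R) = splitDiscriminantClassCM R 2 := by
  refine mk_eq_splitDiscriminantClassCM_two_of_normForm q (AdjoinRoot.of (realPolyQ R) x)
    (AdjoinRoot.of (realPolyQ R) y * t) 1 one_ne_zero ?_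
  rw [hq, map_add, map_mul, map_pow, map_pow, one_pow, mul_one]
  rw [map_neg] at ht
  linear_combination (-(AdjoinRoot.of (realPolyQ R) y) ^ 2) * ht

end KWitness

/-! ### §3 Descent for a binary form `U² + eUV + fV² = ℓ·w·M²` -/

section BinaryDescent

/-- **Descent.** For a prime `ℓ`, a binary form `U² + eUV + fV²` ANISOTROPIC mod `ℓ` and `ℓ ∤ w`, every integer
solution of `U² + eUV + fV² = ℓ·w·M²` has `M = 0`: mod `ℓ` the form vanishes, so `ℓ ∣ U, V`; then `ℓ ∣ wM²`, `ℓ ∣ M`,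
and `(U/ℓ, V/ℓ, M/ℓ)` is a smaller solution. (The local content: `ℓw` has odd valuation at a place where the form
— a norm form inert at `ℓ` — only takes values of even valuation.) [folklore] -/
theorem binaryForm_descent {ℓ : ℕ} (hℓ : ℓ.Prime) (e f : ℤ)
    (haniso : ∀ u v : ZMod ℓ, u ^ 2 + (e : ZMod ℓ) * u * v + (f : ZMod ℓ) * v ^ 2 = 0 → u = 0 ∧ v = 0)
    (w : ℤ) (hw : ¬ (ℓ : ℤ) ∣ w) :
    ∀ (n : ℕ) (U V M : ℤ), -(n : ℤ) ≤ M → M ≤ n → U ^ 2 + e * U * V + f * V ^ 2 = ℓ * w * M ^ 2 → M = 0 := by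
  have hℓ' : Prime (ℓ : ℤ) := Nat.prime_iff_prime_int.mp hℓ
  have hℓ0 : (ℓ : ℤ) ≠ 0 := by exact_mod_cast hℓ.ne_zero
  have hℓ2 : (2 : ℤ) ≤ ℓ := by exact_mod_cast hℓ.two_le
  intro n
  induction n with
  | zero => intro U V M h1 h2 _; omega
  | succ n ih =>
    intro U V M h1 h2 h
    -- reduction mod `ℓ`
    have hUV : ((U : ZMod ℓ)) = 0 ∧ ((V : ZMod ℓ)) = 0 := by
      apply haniso
      have := congrArg (Int.cast : ℤ → ZMod ℓ) h
      push_cast at this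
      rw [this, ZMod.natCast_self, zero_mul, zero_mul]
    obtain ⟨hU, hV⟩ := hUV
    rw [ZMod.intCast_zmod_eq_zero_iff_dvd] at hU hV
    obtain ⟨U', rfl⟩ := hU
    obtain ⟨V', rfl⟩ := hV
    -- `ℓ (U'² + eU'V' + fV'²) = w M²`, so `ℓ ∣ M`
    have h' : (ℓ : ℤ) * (U' ^ 2 + e * U' * V' + f * V' ^ 2) = w * M ^ 2 := by
      have h2 : (ℓ : ℤ) * ((ℓ : ℤ) * (U' ^ 2 + e * U' * V' + f * V' ^ 2)) = (ℓ : ℤ) * (w * M ^ 2) := by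
        linear_combination h
      exact mul_left_cancel₀ hℓ0 h2
    have hM : (ℓ : ℤ) ∣ M := by
      have hd : (ℓ : ℤ) ∣ w * M ^ 2 := ⟨_, h'.symm⟩
      rcases hℓ'.dvd_or_dvd hd with hd | hd
      · exact absurd hd hw
      · exact hℓ'.dvd_of_dvd_pow hd
    obtain ⟨M', rfl⟩ := hM
    have h'' : U' ^ 2 + e * U' * V' + f * V' ^ 2 = ℓ * w * M' ^ 2 := by
      have h3 : (ℓ : ℤ) * (U' ^ 2 + e * U' * V' + f * V' ^ 2) = (ℓ : ℤ) * (ℓ * w * M' ^ 2) := by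
        rw [h']
        ring
      exact mul_left_cancel₀ hℓ0 h3
    -- `|M'| ≤ n` since `|ℓ M'| ≤ n + 1` and `ℓ ≥ 2`
    push_cast at h1 h2
    have hb1 : -(n : ℤ) ≤ M' := by
      by_contra hc
      have hM'0 : M' ≤ 0 := by omega
      have h4 : (ℓ : ℤ) * M' ≤ 2 * M' := mul_le_mul_of_nonpos_right hℓ2 hM'0
      omega
    have hb2 : M' ≤ n := by
      by_contra hc
      have hM'0 : 0 ≤ M' := by omega
      have h4 : 2 * M' ≤ (ℓ : ℤ) * M' := mul_le_mul_of_nonneg_right hℓ2 hM'0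
      omega
    rw [ih U' V' M' hb1 hb2 h'', mul_zero]

/-- **No rational solution**: for a prime `ℓ`, a form `x² + exy + fy²` anisotropic mod `ℓ` and `ℓ ∤ w`, `ℓw` is not
of the form `x² + exy + fy²` with `x, y ∈ ℚ` (clear denominators, `binaryForm_descent`). [folklore] -/
theorem prime_mul_ne_binaryForm {ℓ : ℕ} (hℓ : ℓ.Prime) (e f : ℤ)
    (haniso : ∀ u v : ZMod ℓ, u ^ 2 + (e : ZMod ℓ) * u * v + (f : ZMod ℓ) * v ^ 2 = 0 → u = 0 ∧ v = 0)
    (w : ℤ) (hw : ¬ (ℓ : ℤ) ∣ w) (x y : ℚ) : (ℓ : ℚ) * w ≠ x ^ 2 + e * x * y + f * y ^ 2 := by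
  intro h
  set m : ℕ := x.den * y.den with hm
  have hm0 : (m : ℤ) ≠ 0 := by
    have : 0 < m := by rw [hm]; exact Nat.mul_pos x.den_pos y.den_pos
    exact_mod_cast this.ne'
  have key : ∀ (q : ℚ) (k : ℕ), ((q.num * k : ℤ) : ℚ) = q * (q.den * k : ℕ) := by
    intro q k
    push_cast
    rw [← mul_assoc, Rat.mul_den_eq_num]
  obtain ⟨U, hU⟩ : ∃ U : ℤ, (U : ℚ) = x * m := ⟨x.num * (y.den : ℕ), by rw [key, hm]⟩
  obtain ⟨V, hV⟩ : ∃ V : ℤ, (V : ℚ) = y * m := ⟨y.num * (x.den : ℕ), by rw [key, hm]; push_cast; ring⟩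
  have hZ : U ^ 2 + e * U * V + f * V ^ 2 = ℓ * w * (m : ℤ) ^ 2 := by
    have h' : (U : ℚ) ^ 2 + e * U * V + f * (V : ℚ) ^ 2 = ℓ * w * ((m : ℤ) : ℚ) ^ 2 := by
      rw [hU, hV]
      push_cast
      linear_combination (-((m : ℚ) ^ 2)) * h
    exact_mod_cast h'
  exact hm0 (binaryForm_descent hℓ e f haniso w hw (m : ℤ).natAbs U V m (by omega) (by omega) hZ)

/-- **`x² + fy²` is anisotropic mod `ℓ` when `−f` is a non-square mod `ℓ`** (`u² = −fv²`, `v ≠ 0 ⇒ (u/v)² = −f`).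
[folklore] -/
theorem aniso_sq_add_mul_sq_of_not_isSquare {ℓ : ℕ} [Fact ℓ.Prime] (f : ℤ)
    (hns : ¬ IsSquare ((-f : ℤ) : ZMod ℓ)) :
    ∀ u v : ZMod ℓ, u ^ 2 + ((0 : ℤ) : ZMod ℓ) * u * v + (f : ZMod ℓ) * v ^ 2 = 0 → u = 0 ∧ v = 0 := by
  intro u v h
  rw [Int.cast_zero, zero_mul, zero_mul, add_zero] at h
  by_cases hv : v = 0
  · subst hv
    rw [zero_pow two_ne_zero, mul_zero, add_zero] at h
    exact ⟨pow_eq_zero_iff two_ne_zero |>.mp h, rfl⟩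
  · exfalso
    apply hns
    refine ⟨u * v⁻¹, ?_⟩
    have hv' : v * v⁻¹ = 1 := mul_inv_cancel₀ hv
    push_cast
    linear_combination (-(v⁻¹) ^ 2) * h + ((f : ZMod ℓ) * (v * v⁻¹ + 1)) * hv'

/-- **`u² + uv + v²` is anisotropic mod `2`** (the norm form of `ℤ[ζ₃]`; `2` is inert in `ℚ(√−3)`). [folklore] -/
theorem aniso_two_sq_add_mul_add_sq :
    ∀ u v : ZMod 2, u ^ 2 + ((1 : ℤ) : ZMod 2) * u * v + ((1 : ℤ) : ZMod 2) * v ^ 2 = 0 → u = 0 ∧ v = 0 := by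
  decide

end BinaryDescent

end Summit.HodgeConjecture.HodgeConjecture.Ring2.WeilCoverageCM

end
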